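import Summits.CriticalPhenomena.PercolationContinuityZ3.Theorems.Transplant.SkelFrmQuasiBParamsFaceFloorsPinSYA
import Summits.CriticalPhenomena.PercolationContinuityZ3.Theorems.Transplant.SkelFrmBParamsFaceFloorsPinSYA
import Summits.CriticalPhenomena.PercolationContinuityZ3.Theorems.Transplant.SkelFrmQuasiBParamsFaceFloorsLAdYA
import Summits.CriticalPhenomena.PercolationContinuityZ3.Theorems.Transplant.SkelFrmBParamsFaceFloorsLAdYA
import Summits.CriticalPhenomena.PercolationContinuityZ3.Theorems.Transplant.SkelFrmQuasiBParamsFaceOriginsYLA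
import Summits.CriticalPhenomena.PercolationContinuityZ3.Theorems.Transplant.SkelFrmBParamsFaceOriginsYLA
import Summits.CriticalPhenomena.PercolationContinuityZ3.Theorems.Transplant.SkelFrmQuasiBParamsFaceOriginsXA
import Summits.CriticalPhenomena.PercolationContinuityZ3.Theorems.Transplant.SkelFrmBParamsFaceOriginsXA
import Summits.CriticalPhenomena.PercolationContinuityZ3.Theorems.Transplant.SkelFrmQuasiBParamsFaceOriginsYA
import Summits.CriticalPhenomena.PercolationContinuityZ3.Theorems.Transplant.SkelFrmBParamsFaceOriginsYA
import Summits.CriticalPhenomena.PercolationContinuityZ3.Theorems.Transplant.SkelFrmQuasiBParamsFramesF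
import Summits.CriticalPhenomena.PercolationContinuityZ3.Theorems.Transplant.SkelFrmBParamsFramesF
import Summits.CriticalPhenomena.PercolationContinuityZ3.Theorems.Transplant.SkelFrmQuasiBParamsFaceFloorsClrYF
import Summits.CriticalPhenomena.PercolationContinuityZ3.Theorems.Transplant.SkelFrmBParamsFaceFloorsClrYF
import Summits.CriticalPhenomena.PercolationContinuityZ3.Theorems.Transplant.SkelFrmQuasiBParamsFaceFloorsClrYA
import Summits.CriticalPhenomena.PercolationContinuityZ3.Theorems.Transplant.SkelFrmBParamsFaceFloorsClrYA
import Summits.CriticalPhenomena.PercolationContinuityZ3.Theorems.Transplant.SkelFrmQuasiBParamsFaceFloorsFAYA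
import Summits.CriticalPhenomena.PercolationContinuityZ3.Theorems.Transplant.SkelFrmBParamsFaceFloorsFAYA
import Summits.CriticalPhenomena.PercolationContinuityZ3.Theorems.Transplant.SkelFrmQuasiBParamsFaceFloorsFBYA
import Summits.CriticalPhenomena.PercolationContinuityZ3.Theorems.Transplant.SkelFrmBParamsFaceFloorsFBYA
import Summits.CriticalPhenomena.PercolationContinuityZ3.Theorems.Transplant.SkelFrmQuasiBParamsFaceFloorsFTYA
import Summits.CriticalPhenomena.PercolationContinuityZ3.Theorems.Transplant.SkelFrmBParamsFaceFloorsFTYA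
import Summits.CriticalPhenomena.PercolationContinuityZ3.Theorems.Transplant.SkelFrmQuasiBParamsFaceFloorsLYA
import Summits.CriticalPhenomena.PercolationContinuityZ3.Theorems.Transplant.SkelFrmBParamsFaceFloorsLYA
import Summits.CriticalPhenomena.PercolationContinuityZ3.Theorems.Transplant.SkelFrmQuasiBParamsFaceFloorsQYA
import Summits.CriticalPhenomena.PercolationContinuityZ3.Theorems.Transplant.SkelFrmBParamsFaceFloorsQYA
import Summits.CriticalPhenomena.PercolationContinuityZ3.Theorems.Transplant.SkelFrmQuasiBParamsFaceFloorsZPiYA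
import Summits.CriticalPhenomena.PercolationContinuityZ3.Theorems.Transplant.SkelFrmBParamsFaceFloorsZPiYA
import Summits.CriticalPhenomena.PercolationContinuityZ3.Theorems.Transplant.SkelFrmQuasiBParamsFaceFloorsZYA
import Summits.CriticalPhenomena.PercolationContinuityZ3.Theorems.Transplant.SkelFrmBParamsFaceFloorsZYA
import Summits.CriticalPhenomena.PercolationContinuityZ3.Theorems.Transplant.SkelFrmQuasiBParamsFaceFloorsPinYA
import Summits.CriticalPhenomena.PercolationContinuityZ3.Theorems.Transplant.SkelFrmBParamsFaceFloorsPinYA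
import Summits.CriticalPhenomena.PercolationContinuityZ3.Theorems.Transplant.SkelFrmQuasiBParamsFaceCountsYA
import Summits.CriticalPhenomena.PercolationContinuityZ3.Theorems.Transplant.SkelFrmBParamsFaceCountsYA
import Summits.CriticalPhenomena.PercolationContinuityZ3.Theorems.Transplant.SkelFrmQuasiBParamsFaceCountsRangeYA
import Summits.CriticalPhenomena.PercolationContinuityZ3.Theorems.Transplant.SkelFrmBParamsFaceCountsRangeYA
import Summits.CriticalPhenomena.PercolationContinuityZ3.Theorems.Transplant.SkelFrmQuasiBParamsFaceCountsShiftYA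
import Summits.CriticalPhenomena.PercolationContinuityZ3.Theorems.Transplant.SkelFrmBParamsFaceCountsShiftYA
import Summits.CriticalPhenomena.PercolationContinuityZ3.Theorems.Transplant.SkelPhiFaceNumsYP2T
import Summits.CriticalPhenomena.PercolationContinuityZ3.Theorems.Transplant.SkelFrmQuasiBChoiceWindow
import Summits.CriticalPhenomena.PercolationContinuityZ3.Theorems.Transplant.SkelFrmBChoiceWindow
import Summits.CriticalPhenomena.PercolationContinuityZ3.Theorems.Transplant.PlanarSkeletonFrmQuasiDefs
import Summits.CriticalPhenomena.PercolationContinuityZ3.Theorems.Transplant.PlanarSkeletonFrmDefs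
import Summits.CriticalPhenomena.PercolationContinuityZ3.Theorems.Transplant.SkelPhiStepIDataNS
import Summits.CriticalPhenomena.PercolationContinuityZ3.Theorems.Transplant.SkelFrmFromBParamsFaceFloorsY2SA
import Summits.CriticalPhenomena.PercolationContinuityZ3.Theorems.Transplant.SkelFrmBParamsFaceFloorsY2SA
import Summits.CriticalPhenomena.PercolationContinuityZ3.Theorems.Transplant.SkelFrmQuasiBParamsFaceFloorsY2WA
import Summits.CriticalPhenomena.PercolationContinuityZ3.Theorems.Transplant.SkelFrmBParamsFaceFloorsY2WA
import Summits.CriticalPhenomena.PercolationContinuityZ3.Theorems.Transplant.SkelFrmQuasiBParamsFaceFloorsYxC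
import Summits.CriticalPhenomena.PercolationContinuityZ3.Theorems.Transplant.SkelFrmBParamsFaceFloorsYxC
import Summits.CriticalPhenomena.PercolationContinuityZ3.Theorems.Transplant.SkelFrmQuasiBParamsFaceFloorsLXA
import Summits.CriticalPhenomena.PercolationContinuityZ3.Theorems.Transplant.SkelFrmBParamsFaceFloorsLXA
import Summits.CriticalPhenomena.PercolationContinuityZ3.Theorems.Transplant.SkelFrmQuasiBParamsFaceFloorsX2WA
import Summits.CriticalPhenomena.PercolationContinuityZ3.Theorems.Transplant.SkelFrmBParamsFaceFloorsX2WA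
import Summits.CriticalPhenomena.PercolationContinuityZ3.Theorems.Transplant.SkelFrmQuasiBParamsFaceFloorsClrXA
import Summits.CriticalPhenomena.PercolationContinuityZ3.Theorems.Transplant.SkelFrmBParamsFaceFloorsClrXA
import Summits.CriticalPhenomena.PercolationContinuityZ3.Theorems.Transplant.SkelFrmQuasi1SlotTypes
import HarnessLib
import Summits.CriticalPhenomena.PercolationContinuityZ3.Theorems.Transplant.SkelFrmBParamsFaceFloorsYxD
/-!
# GEN-Q PORT (WAVE-Q table v0.8 section 2, row G228, U-level L25; captain R-6/R-7 2026-08-27: carrier token swap `PlanarSkeletonFrmFrom ↦ PlanarSkeletonFrmQuasi`)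
# of the tree module «Transplant/SkelFrmFromBParamsFaceFloorsYxD» (sha256 3bf6a7050bbec032…) onto the quasi-step carrier `PlanarSkeletonFrmQuasi` (p507026): «SkelFrmQuasiBParamsFaceFloorsYxD»

HAND HUNK (L-FLOORMAP-1 ①⑥ / L-KitS-1 reader side; G017 «SkelFrmQuasiBChoiceNums», hp-8's KitSN): R'0×12 — the (S0) kit of record at window cost `KS.NQ Φ`.

ORIGINAL TITLE: N2 (frames-only node, OPEN) — (F) column, (R-49)(c2b) VALUE LAYER part D: **THE TARGET ROWS OF THE X4-SHAPED y′-FACE ROUTE** (hp-8 g43)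

builds on p205010 (kernel theorem, internal audit signed; external expert review pending) — nothing in this file uses p205010; NOTHING is claimed about any open node
((N3-b), the end state).  Lane `prim-bschramm`, seat `prim-bschramm-stmt` (gen 33; GEN-Q column pen; tool = captain gen-1 g4's port_genq.py R-14 --cone + p3-g30's T1 patch).  Helper file (`--supports stmt-CriticalPhenomena-4575 --as helper`).
PORT RULES (U-wave r1–r4 re-used, GEN-Q hunk classes of p3-g29 #6136): declaration order, names and proof texts are those of «SkelFrmFromBParamsFaceFloorsYxD», byte-identical except
(i) the carrier token `PlanarSkeletonFrmFrom ↦ PlanarSkeletonFrmQuasi` in binders, `namespace`/`end` lines and qualified names (module names `SkelFrmFrom… ↦ SkelFrmQuasi…`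
in imports of already-ported rows); (ii) `Φ.step ↦ Φ.qstep` with the called Steps lemma replaced by its `…Q`/`_q` twin and the cost `Φ.M` threaded (none in this file unless
listed below); (iii) `Φ.cyl_connected ↦ Φ.cyl_reach` readers (none unless listed); (iv) graph-ball radii / window floors ×`Φ.M` (none unless listed).  Carrier-free
residents stay imported/exported from the original «SkelFrmBParamsFaceFloorsYxD» exactly as in the FrmFrom port.  Docstrings and citations are the original's.

-/

noncomputable section

open scoped Classical

namespace Summit.CriticalPhenomena.PercolationContinuityZ3.Theorems.Transplant

namespace PlanarSkeletonFrmQuasi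

namespace NegB

open Literature.Probability.Percolation Literature.Probability.LatticeModels SimpleGraph KNCells KNLevels
open Literature.Probability.Percolation.KozmaNitzan.Cells (oth sgOf sgOf_sign stepVec_apply_fst)
open SkelConc (Consts)
open Skelφ (shearUnit shearUnit_pos yBoxLoS yBoxHiS ySLo ySHi yBnd yBndC xBoxB xSLo xSHi xBoxLoA xBoxHiA crossOffY crossOffX yPrmW xCoreB xCSLo xCSHi)
open Skelφ.StepI (DataN)
open ChainPlanar (BridgePrm)
open TwoAxis.Para (modulus)
open Neg

namespace KS

/-- **`FL1` of the X4-shaped route, generic**: if the junction reading clears the box's near edge by `6u₀ + 3` (`T0Y − small3 0 + 6u₀ + 3 ≤ F`),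
the last core's lower abscissa end is inside the arrival box (`yBndC_env`: core half-width `≤ 6u₀`). [cite: KozmaNitzan2024, §4 Lemma 12 (pp. 23–25)] -/
theorem FL1_Yx (κ : Consts) {V : Type} [DecidableEq V] [Countable V] {G : SimpleGraph V} [G.LocallyFinite] (Φ : PlanarSkeletonFrmQuasi G) (t : V) (p : unitInterval) (D : Skelφ.StepI.DataNS V) (g : ℕ) (f : ℕ) (mk : ℕ) (P : PCells2T) (hN : EqNumL κ Φ t p D g f) (hκ : (hL κ Φ t p D g f).natAbs ≤ 10 * nL κ Φ t p D g f) (x : Site 2) (du : MDir) (z yT : Site 2)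
    {N₃ : ℕ} (hk : (((N₃ + 1 : ℕ) : ℤ)) * ((KS0.R'0N κ Φ (KS.NQ Φ) t p D mk) : ℤ) ≤ nL κ Φ t p D g f)
    (hℓ : 11 * (2 * ((N₃ + 1 : ℕ) : ℤ) + (((N₃ + 1 : ℕ) : ℤ) + 1000 * Neg.Kq κ) * ((KS0.R'0N κ Φ (KS.NQ Φ) t p D mk) : ℤ) + 8) ≤ 2 * (ℓL κ Φ t p D g f : ℤ))
    (hF : T0Y P x du z - ((NegB.BSlot.small3 κ Φ t p D g f 0 : ℕ) : ℤ) + 6 * u₀A κ Φ t p D g f + 3 ≤ FcA κ Φ t p D g f yT) :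
    (nL κ Φ t p D g f : ℤ) * modulus (nL κ Φ t p D g f) (hL κ Φ t p D g f) (vL κ Φ t p D g f) (vβL κ Φ t p D g f) *
        (P.cenS (x + stepVec du) 0 - ((NegB.BSlot.small3 κ Φ t p D g f 0 : ℕ) : ℤ) + 2 - z 0 - FcA κ Φ t p D g f yT) ≤
      -(u₀A κ Φ t p D g f * (yBndC (nL κ Φ t p D g f) (hL κ Φ t p D g f) (modulus (nL κ Φ t p D g f) (hL κ Φ t p D g f) (vL κ Φ t p D g f) (vβL κ Φ t p D g f)) (qB3XA κ Φ t p D g f (KS0.R'0N κ Φ (KS.NQ Φ) t p D mk)) (KS0.R'0N κ Φ (KS.NQ Φ) t p D mk) (N₃ + 1) + 2 * (nL κ Φ t p D g f : ℤ))) -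
        (nL κ Φ t p D g f : ℤ) * modulus (nL κ Φ t p D g f) (hL κ Φ t p D g f) (vL κ Φ t p D g f) (vβL κ Φ t p D g f) := by
  obtain ⟨hn1, hℓ1⟩ := one_le_of_eqNumL κ Φ t p D g f hN
  have hm0 : 0 < modulus (nL κ Φ t p D g f) (hL κ Φ t p D g f) (vL κ Φ t p D g f) (vβL κ Φ t p D g f) := Skelφ.NegPrm.modulus_vβOf_pos hn1 hℓ1 _ _
  have henv := yBndC_env κ Φ t p D g f mk hN hκ hk hℓ
  have hu : 1 ≤ u₀A κ Φ t p D g f := (units_eqA κ Φ t p D g f).2.2.2.2.1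
  have hn1' : (1 : ℤ) ≤ (nL κ Φ t p D g f : ℤ) := by exact_mod_cast hn1
  have hT : T0Y P x du z = P.cenS (x + stepVec du) 0 - z 0 := rfl
  set n : ℤ := (nL κ Φ t p D g f : ℤ)
  set m := modulus (nL κ Φ t p D g f) (hL κ Φ t p D g f) (vL κ Φ t p D g f) (vβL κ Φ t p D g f)
  set u := u₀A κ Φ t p D g f
  set F := FcA κ Φ t p D g f yT
  set b : ℤ := ((NegB.BSlot.small3 κ Φ t p D g f 0 : ℕ) : ℤ)
  set Bc := yBndC (nL κ Φ t p D g f) (hL κ Φ t p D g f) m (qB3XA κ Φ t p D g f (KS0.R'0N κ Φ (KS.NQ Φ) t p D mk)) (KS0.R'0N κ Φ (KS.NQ Φ) t p D mk) (N₃ + 1)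
  have e : P.cenS (x + stepVec du) 0 - b + 2 - z 0 - F = T0Y P x du z - b + 2 - F := by rw [hT]; ring
  rw [e]
  have hnm : 0 < n * m := mul_pos (by linarith) hm0
  have hBn : u * (Bc + 2 * n) ≤ u * (6 * n * m) := mul_le_mul_of_nonneg_left henv (by linarith)
  have key : n * m * (T0Y P x du z - b + 2 - F) + u * (6 * n * m) + n * m ≤ 0 := by
    have : n * m * (T0Y P x du z - b + 2 - F + 6 * u + 1) ≤ n * m * 0 := mul_le_mul_of_nonneg_left (by linarith) hnm.le
    linarith
  linarith

/-- **`FL2` of the X4-shaped route, generic**: if the junction reading stays `6u₀ + 3` inside the box's far edge (`F + 6u₀ + 3 ≤ T0Y + small3 0`),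
the last core's upper abscissa end is inside the arrival box. [cite: KozmaNitzan2024, §4 Lemma 12 (pp. 23–25)] -/
theorem FL2_Yx (κ : Consts) {V : Type} [DecidableEq V] [Countable V] {G : SimpleGraph V} [G.LocallyFinite] (Φ : PlanarSkeletonFrmQuasi G) (t : V) (p : unitInterval) (D : Skelφ.StepI.DataNS V) (g : ℕ) (f : ℕ) (mk : ℕ) (P : PCells2T) (hN : EqNumL κ Φ t p D g f) (hκ : (hL κ Φ t p D g f).natAbs ≤ 10 * nL κ Φ t p D g f) (x : Site 2) (du : MDir) (z yT : Site 2)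
    {N₃ : ℕ} (hk : (((N₃ + 1 : ℕ) : ℤ)) * ((KS0.R'0N κ Φ (KS.NQ Φ) t p D mk) : ℤ) ≤ nL κ Φ t p D g f)
    (hℓ : 11 * (2 * ((N₃ + 1 : ℕ) : ℤ) + (((N₃ + 1 : ℕ) : ℤ) + 1000 * Neg.Kq κ) * ((KS0.R'0N κ Φ (KS.NQ Φ) t p D mk) : ℤ) + 8) ≤ 2 * (ℓL κ Φ t p D g f : ℤ))
    (hF : FcA κ Φ t p D g f yT + 6 * u₀A κ Φ t p D g f + 3 ≤ T0Y P x du z + ((NegB.BSlot.small3 κ Φ t p D g f 0 : ℕ) : ℤ)) :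
    (nL κ Φ t p D g f : ℤ) * modulus (nL κ Φ t p D g f) (hL κ Φ t p D g f) (vL κ Φ t p D g f) (vβL κ Φ t p D g f) * (FcA κ Φ t p D g f yT + 1) +
        u₀A κ Φ t p D g f * (yBndC (nL κ Φ t p D g f) (hL κ Φ t p D g f) (modulus (nL κ Φ t p D g f) (hL κ Φ t p D g f) (vL κ Φ t p D g f) (vβL κ Φ t p D g f)) (qB3XA κ Φ t p D g f (KS0.R'0N κ Φ (KS.NQ Φ) t p D mk)) (KS0.R'0N κ Φ (KS.NQ Φ) t p D mk) (N₃ + 1) + nL κ Φ t p D g f) ≤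
      (nL κ Φ t p D g f : ℤ) * modulus (nL κ Φ t p D g f) (hL κ Φ t p D g f) (vL κ Φ t p D g f) (vβL κ Φ t p D g f) * (P.cenS (x + stepVec du) 0 + ((NegB.BSlot.small3 κ Φ t p D g f 0 : ℕ) : ℤ) - 2 - z 0) := by
  obtain ⟨hn1, hℓ1⟩ := one_le_of_eqNumL κ Φ t p D g f hN
  have hm0 : 0 < modulus (nL κ Φ t p D g f) (hL κ Φ t p D g f) (vL κ Φ t p D g f) (vβL κ Φ t p D g f) := Skelφ.NegPrm.modulus_vβOf_pos hn1 hℓ1 _ _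
  have henv := yBndC_env κ Φ t p D g f mk hN hκ hk hℓ
  have hu : 1 ≤ u₀A κ Φ t p D g f := (units_eqA κ Φ t p D g f).2.2.2.2.1
  have hn1' : (1 : ℤ) ≤ (nL κ Φ t p D g f : ℤ) := by exact_mod_cast hn1
  have hT : T0Y P x du z = P.cenS (x + stepVec du) 0 - z 0 := rfl
  set n : ℤ := (nL κ Φ t p D g f : ℤ)
  set m := modulus (nL κ Φ t p D g f) (hL κ Φ t p D g f) (vL κ Φ t p D g f) (vβL κ Φ t p D g f)
  set u := u₀A κ Φ t p D g f
  set F := FcA κ Φ t p D g f yT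
  set b : ℤ := ((NegB.BSlot.small3 κ Φ t p D g f 0 : ℕ) : ℤ)
  set Bc := yBndC (nL κ Φ t p D g f) (hL κ Φ t p D g f) m (qB3XA κ Φ t p D g f (KS0.R'0N κ Φ (KS.NQ Φ) t p D mk)) (KS0.R'0N κ Φ (KS.NQ Φ) t p D mk) (N₃ + 1)
  have e : P.cenS (x + stepVec du) 0 + b - 2 - z 0 = T0Y P x du z + b - 2 := by rw [hT]; ring
  rw [e]
  have hnm : 0 < n * m := mul_pos (by linarith) hm0
  have hBn : u * (Bc + n) ≤ u * (6 * n * m) := mul_le_mul_of_nonneg_left (by linarith) (by linarith)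
  have key : n * m * (F + 1) + u * (6 * n * m) ≤ n * m * (T0Y P x du z + b - 2) := by
    have : n * m * (F + 1 + 6 * u) ≤ n * m * (T0Y P x du z + b - 2) := mul_le_mul_of_nonneg_left (by linarith) hnm.le
    linarith
  linarith

/-- **The junction's abscissa is inside the corrector window** (one-sided): `T0Y − bwY ≤ FcA yT` and `FcA yT + 6u₀ + 3 ≤ T0Y + small3 0`, from
`N3WY_spec` at the prefix's start reading `yTX0 yL σ` (`N_x = max 6 N3WY`: the forced strides only move the junction further in, and are
covered by the start row `12u₀ + 5 ≤ T0Y + bwY` when `N3WY < 6`), `bwY = small3 0 − 7u₀`, `|FcA (yTX0 yL σ) − FcA yL| ≤ u₀ + 2`, `|FcA yL| ≤ 5u₀`. [folklore] -/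
theorem juncYx_window (κ : Consts) {V : Type} [DecidableEq V] [Countable V] {G : SimpleGraph V} [G.LocallyFinite] (Φ : PlanarSkeletonFrmQuasi G) (t : V) (p : unitInterval) (D : Skelφ.StepI.DataNS V) (g : ℕ) (f : ℕ) (hN : EqNumL κ Φ t p D g f) (P : PCells2T) (x : Site 2) (du : MDir) (hsg : sgOf du = 1) (z yL : Site 2)
    (he : |FcA κ Φ t p D g f yL| ≤ 5 * u₀A κ Φ t p D g f) (hu11 : 11 ≤ u₀A κ Φ t p D g f) (hTw : 12 * u₀A κ Φ t p D g f + 5 ≤ T0Y P x du z + (bwY κ Φ t p D g f : ℤ)) :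
    T0Y P x du z - (bwY κ Φ t p D g f : ℤ) ≤ FcA κ Φ t p D g f (yTYx κ Φ t p D g f P yL x du z (bwY κ Φ t p D g f)) ∧
      FcA κ Φ t p D g f (yTYx κ Φ t p D g f P yL x du z (bwY κ Φ t p D g f)) + 6 * u₀A κ Φ t p D g f + 3 ≤ T0Y P x du z + ((NegB.BSlot.small3 κ Φ t p D g f 0 : ℕ) : ℤ) := by
  obtain ⟨eF, hdx⟩ := juncYx_FcA κ Φ t p D g f hN P yL x du z (bwY κ Φ t p D g f)
  have eσ : sgOf du * u₀A κ Φ t p D g f * ((NxW κ Φ t p D g f P yL x du z (bwY κ Φ t p D g f) : ℤ) + 1) = u₀A κ Φ t p D g f * ((NxW κ Φ t p D g f P yL x du z (bwY κ Φ t p D g f) : ℤ) + 1) := by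
    rw [hsg, one_mul]
  rw [eF, eσ]
  obtain ⟨hbw, hbw2⟩ := bwY_eq κ Φ t p D g f
  have hu : 1 ≤ u₀A κ Φ t p D g f := (units_eqA κ Φ t p D g f).2.2.2.2.1
  obtain ⟨e1, e2⟩ := abs_le.1 he
  obtain ⟨x1, x2⟩ := abs_le.1 hdx
  set u := u₀A κ Φ t p D g f with hu_def
  set F0 := FcA κ Φ t p D g f (yTX0 κ Φ t p D g f yL (sgOf du))
  have hF : F0 + u ≤ T0Y P x du z + (bwY κ Φ t p D g f : ℤ) := by linarith
  obtain ⟨-, hWlo, hWhi⟩ := N3WY_spec κ Φ t p D g f P (yTX0 κ Φ t p D g f yL (sgOf du)) x du z hbw2 hF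
  rw [one_mul] at hWlo hWhi
  -- `N_x = max 6 N`
  have hNx : ((NxW κ Φ t p D g f P yL x du z (bwY κ Φ t p D g f) : ℤ) = 6 ∧ ((N3WY κ Φ t p D g f P (yTX0 κ Φ t p D g f yL (sgOf du)) x du z (bwY κ Φ t p D g f) : ℕ) : ℤ) ≤ 6) ∨ (NxW κ Φ t p D g f P yL x du z (bwY κ Φ t p D g f) : ℤ) = ((N3WY κ Φ t p D g f P (yTX0 κ Φ t p D g f yL (sgOf du)) x du z (bwY κ Φ t p D g f) : ℕ) : ℤ) := by
    unfold NxW NX0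
    rcases le_total 6 (N3WY κ Φ t p D g f P (yTX0 κ Φ t p D g f yL (sgOf du)) x du z (bwY κ Φ t p D g f)) with h | h
    · right; rw [max_eq_right h]
    · left; rw [max_eq_left h]; exact ⟨by norm_num, by exact_mod_cast h⟩
  have hu3 : 3 ≤ u := by
    have := (units_eqA κ Φ t p D g f).2.2.2.2.1; linarith [hu11]
  rcases hNx with ⟨h5, hN5⟩ | hNN
  · rw [h5]
    have : u * ((N3WY κ Φ t p D g f P (yTX0 κ Φ t p D g f yL (sgOf du)) x du z (bwY κ Φ t p D g f) : ℕ) : ℤ) ≤ u * 6 := mul_le_mul_of_nonneg_left hN5 (by linarith)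
    have hN0 : (0 : ℤ) ≤ ((N3WY κ Φ t p D g f P (yTX0 κ Φ t p D g f yL (sgOf du)) x du z (bwY κ Φ t p D g f) : ℕ) : ℤ) := by positivity
    constructor <;> nlinarith
  · rw [hNN]
    constructor <;> linarith

/-- **The landing level is inside the x-face corrector's level window** (the `hNT` premises of `FL3_XW/FL4_XW` at the junction): with the along
count `N_y := NrY` read at the junction `yT` (`F1cA yT = F1cA (yTX0 yL σ)`), `T1Y − bwX ≤ F1cA yL + u₁·(N_y + 1) ≤ T1Y + bwX` one-sided
(`NrY_spec`: landing within `u₁`; `|F1cA (yTX0 yL σ) − F1cA yL| ≤ 2`; `bwX = small3 1 − 6u₁ ≥ u₁ + 2`). [folklore] -/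
theorem juncYx_levelwin (κ : Consts) {V : Type} [DecidableEq V] [Countable V] {G : SimpleGraph V} [G.LocallyFinite] (Φ : PlanarSkeletonFrmQuasi G) (t : V) (p : unitInterval) (D : Skelφ.StepI.DataNS V) (g : ℕ) (f : ℕ) (hN : EqNumL κ Φ t p D g f) (P : PCells2T) (x : Site 2) (du : MDir) (hsg : sgOf du = 1) (z yL : Site 2) (bw : ℕ)
    (hX : u₁A κ Φ t p D g f ≤ sgOf du * (T1Y P x du z - F1cA κ Φ t p D g f (yTYx κ Φ t p D g f P yL x du z bw))) (hu3 : 3 ≤ u₁A κ Φ t p D g f) :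
    T1X P x du z - (bwX κ Φ t p D g f : ℤ) ≤ F1cA κ Φ t p D g f yL + 1 * u₁A κ Φ t p D g f * (((NrY κ Φ t p D g f P (yTYx κ Φ t p D g f P yL x du z bw) x du z + 1 : ℕ) : ℤ)) ∧
      F1cA κ Φ t p D g f yL + 1 * u₁A κ Φ t p D g f * (((NrY κ Φ t p D g f P (yTYx κ Φ t p D g f P yL x du z bw) x du z + 1 : ℕ) : ℤ)) ≤ T1X P x du z + (bwX κ Φ t p D g f : ℤ) := by
  have hT : T1X P x du z = T1Y P x du z := rfl
  obtain ⟨eF1, -⟩ := juncYx_F1cA κ Φ t p D g f hN P yL x du z bw (le_refl |F1cA κ Φ t p D g f yL|)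
  have hsh := F1cA_yTX0_sub_abs_le κ Φ t p D g f hN yL (sgOf du)
  obtain ⟨hsp, -⟩ := NrY_spec κ Φ t p D g f P (yTYx κ Φ t p D g f P yL x du z bw) x du z hX
  rw [hsg, one_mul] at hsp
  rw [eF1] at hsp
  obtain ⟨s1, s2⟩ := abs_le.1 hsh
  obtain ⟨p1, p2⟩ := abs_le.1 hsp
  have hb := (bwX_eq κ Φ t p D g f).1
  have hb3 := (NegB.small3_eq κ Φ t p D g f).2
  have eb : (bwX κ Φ t p D g f : ℤ) = 13 * u₁A κ Φ t p D g f := by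
    rw [hb, hb3]; unfold u₁A; push_cast; ring
  rw [hT, eb]; push_cast
  constructor <;> linarith

end KS

end NegB

end PlanarSkeletonFrmQuasi

end Summit.CriticalPhenomena.PercolationContinuityZ3.Theorems.Transplant

end
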